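import Summits.QuantumFields.YangMills.Theorems.BalabanLadderIRTypBallSparse
import Summits.QuantumFields.YangMills.Theorems.BalabanLadderIRTorusUpgradeMixed
import HarnessLib

/-!
# The ball-sparse factor at the card's scales: its (iii_T) budget tends to zero, and it composes with bulk factors

Support file (seat ym-infvol-p3, fleet R136 (i); crux `IR` = stmt-QuantumFields-19354, registered line «af-pincer-T»,
format `TypShellCond ρ β b n ε δ`, stub `stub_onsetT : OnsetMixingTypical` — «`∀ δ > 0, ∃ β₂, ∀ β ≥ β₂, ∃ b ≥ 1,
TypShellCond r.ρ β b n ε δ`»; count-neutral helper).  Two turnkey forms of the torus anchor of the ball-sparse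
small-field factor `typBallSparse` (`…IRTypBallSparse`, `torusAnchor_typBallSparse`) for the lead:

* **`torusAnchor_typBallSparse_eventually`** — at the card's scales `(t₀, R, D) = (K log β / β, ⌈β⌉₊, ⌈A β⌉₊)`
  (card rev 4 §T: `(K log β / β, β, A β)`) and for meshes `b` with `log b ≤ C β` (every `b ≲ ξ(β)`), with
  `K = 72 (5 + D₁/6)` (`D₁` the volume-free log-partition constant of the representation): for every `δ > 0` there is
  `β₂` beyond which clause (iii_T) of `TypShellCond` holds for `Typ := typBallSparse r.ρ w (K log β / β) ⌈β⌉₊ ⌈A β⌉₊`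
  with budget `δ`, on every odd torus `2S+1 ≥ 4b`, uniformly in the frame and in `b` — i.e. in exactly the quantifier
  order of `OnsetMixingTypical` (`δ` first, then `β₂`, then any admissible `b`).  Arithmetic: the anchor's base is
  `36 (2b)⁴ g(β)^(D+1)` with `g(β) = 6 (4⌈β⌉₊+1)⁴ e^{K₀/6} β^{D₁/6 - K/72} ≤ e^{c₀}/β`, hence
  `≤ 576 e^{4Cβ} e^{Aβ (c₀ - log β)} ≤ 576 e^{-β}` once `A log β ≥ 4C + A c₀ + 1`.
* **`torusJointRarity_typBallSparse_inter`** — clause (iii_T) for `typBallSparse ∩ Typ₂` with budget `δ_bs + δ₂` for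
  any cell-local measurable `Typ₂` with single-cell sup-`ζ` kernel rarity `δ₂` (the mixed torus upgrade
  `IRRarityUpgrade.torusJointRarity_inter` fed with `torusAnchor_typBallSparse`).

Everything here is proved (no `sorry`, no new axioms).  NOT covered (honest): (ii_T) for the ball-sparse factor (kernel
level, small threshold — the LDP debt of record, owner R37 (b)) and (i_T).  HONEST FRAMING: real-analysis and
torus-DLR bookkeeping for ONE `Typ` factor of a registered line of a CONDITIONAL chain; not a gap, not Clay.
-/

set_option autoImplicit false

noncomputable section

open MeasureTheory Finset
open Literature.MathematicalPhysics
open Literature.MathematicalPhysics.QuantumFieldTheory Literature.MathematicalPhysics.QuantumLattice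
open Summit.QuantumFields.YangMills.Cruxes.IR.Tempered (cellEdges regionEdges)

namespace Summit.QuantumFields.YangMills.Theorems.OddTorusChessboard

variable {G : Type} [Group G] [TopologicalSpace G] [IsTopologicalGroup G] [CompactSpace G]
  [MeasurableSpace G] [BorelSpace G]

/-- There are six plaquette orientations in four dimensions. -/
theorem card_orient_four : Fintype.card (Orient 4) = 6 := by decide

/-! ### §1 Arithmetic of the budget at the card's scales -/

omit [TopologicalSpace G] [IsTopologicalGroup G] [CompactSpace G] [MeasurableSpace G] [BorelSpace G] in
/-- The mesh factor: `log b ≤ C β` gives `(2b)⁴ ≤ 16 e^{4Cβ}`. -/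
theorem two_mul_pow_four_le {b : ℕ} (hb : 1 ≤ b) {C β : ℝ} (hbC : Real.log b ≤ C * β) :
    (2 * (b : ℝ)) ^ 4 ≤ 16 * Real.exp (4 * C * β) := by
  have hb0 : (0 : ℝ) < b := by exact_mod_cast hb
  have hble : (b : ℝ) ≤ Real.exp (C * β) := by
    rw [← Real.exp_log hb0]
    exact Real.exp_le_exp.2 hbC
  have h4 : (b : ℝ) ^ 4 ≤ Real.exp (C * β) ^ 4 := pow_le_pow_left₀ hb0.le hble 4
  rw [← Real.exp_nat_mul] at h4
  calc (2 * (b : ℝ)) ^ 4 = 16 * (b : ℝ) ^ 4 := by ring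
    _ ≤ 16 * Real.exp ((4 : ℕ) * (C * β)) := by linarith
    _ = 16 * Real.exp (4 * C * β) := by push_cast; ring_nf

omit [TopologicalSpace G] [IsTopologicalGroup G] [CompactSpace G] [MeasurableSpace G] [BorelSpace G] in
/-- The per-plaquette gain at the card's scales: with `K = 72 (5 + D₁/6)`, `R = ⌈β⌉₊`, `β ≥ 1`,
`6 (4R+1)⁴ exp (-K log β / 72 + (K₀ + D₁ log β) / 6) ≤ exp (c₀ - log β)`, `c₀ = log (6·9⁴) + K₀/6`. -/
theorem gain_le (K₀ : ℝ) (D₁ : ℕ) {β : ℝ} (hβ : 1 ≤ β) :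
    ((4 * (⌈β⌉₊ : ℝ) + 1) ^ 4 * 6) *
        Real.exp (-(72 * (5 + (D₁ : ℝ) / 6)) * Real.log β / 72 + (K₀ + D₁ * Real.log β) / 6) ≤
      Real.exp (Real.log (6 * 9 ^ 4) + K₀ / 6 - Real.log β) := by
  have hβ0 : 0 < β := by linarith
  have hR : (4 * (⌈β⌉₊ : ℝ) + 1) ≤ 9 * β := by
    have := Nat.ceil_lt_add_one hβ0.le
    linarith
  have hR0 : 0 ≤ 4 * (⌈β⌉₊ : ℝ) + 1 := by positivity
  have hR4 : (4 * (⌈β⌉₊ : ℝ) + 1) ^ 4 ≤ (9 * β) ^ 4 := pow_le_pow_left₀ hR0 hR 4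
  have hβ4 : β ^ 4 = Real.exp ((4 : ℕ) * Real.log β) := by
    rw [Real.exp_nat_mul, Real.exp_log hβ0]
  have hexp : Real.exp (-(72 * (5 + (D₁ : ℝ) / 6)) * Real.log β / 72 + (K₀ + D₁ * Real.log β) / 6) =
      Real.exp (K₀ / 6 - 5 * Real.log β) := by
    congr 1; ring
  rw [hexp]
  calc (4 * (⌈β⌉₊ : ℝ) + 1) ^ 4 * 6 * Real.exp (K₀ / 6 - 5 * Real.log β)
      ≤ (9 * β) ^ 4 * 6 * Real.exp (K₀ / 6 - 5 * Real.log β) := by gcongr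
    _ = (6 * 9 ^ 4) * (β ^ 4 * Real.exp (K₀ / 6 - 5 * Real.log β)) := by ring
    _ = Real.exp (Real.log (6 * 9 ^ 4) + K₀ / 6 - Real.log β) := by
        rw [hβ4, ← Real.exp_add, ← Real.exp_log (show (0 : ℝ) < 6 * 9 ^ 4 by norm_num), ← Real.exp_add,
          Real.log_exp]
        congr 1; push_cast; ring

omit [TopologicalSpace G] [IsTopologicalGroup G] [CompactSpace G] [MeasurableSpace G] [BorelSpace G] in
/-- **The budget at the card's scales is eventually below any `δ > 0`.**  For `β ≥ β₂(δ)` (explicit), every `b ≥ 1`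
with `log b ≤ C β`, with `K = 72 (5 + D₁/6)`, `R = ⌈β⌉₊`, `D = ⌈A β⌉₊`, `λ = β/2`, `t₀ = K log β / β`:
`36 (2b)⁴ ((4R+1)⁴ 6)^(D+1) exp ((D+1) (-K log β / 72 + (K₀ + D₁ log β)/6)) ≤ δ`. -/
theorem budget_le (K₀ : ℝ) (D₁ : ℕ) {A C : ℝ} {δ : ℝ} (hδ : 0 < δ) {β : ℝ}
    (hβ1 : 1 ≤ β) (hβc₀ : Real.log (6 * 9 ^ 4) + K₀ / 6 ≤ Real.log β)
    (hβC : 4 * C + A * (Real.log (6 * 9 ^ 4) + K₀ / 6) + 1 ≤ A * Real.log β)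
    (hβδ : Real.log (576 / δ) ≤ β) {b : ℕ} (hb : 1 ≤ b) (hbC : Real.log b ≤ C * β) :
    36 * (2 * (b : ℝ)) ^ 4 * ((((4 * (⌈β⌉₊ : ℝ) + 1) ^ 4 * 6) *
        Real.exp (-(72 * (5 + (D₁ : ℝ) / 6)) * Real.log β / 72 + (K₀ + D₁ * Real.log β) / 6)) ^ (⌈A * β⌉₊ + 1)) ≤
      δ := by
  set c₀ : ℝ := Real.log (6 * 9 ^ 4) + K₀ / 6 with hc₀
  set g : ℝ := ((4 * (⌈β⌉₊ : ℝ) + 1) ^ 4 * 6) *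
    Real.exp (-(72 * (5 + (D₁ : ℝ) / 6)) * Real.log β / 72 + (K₀ + D₁ * Real.log β) / 6) with hg
  have hβ0 : 0 < β := by linarith
  have hg0 : 0 ≤ g := by positivity
  have hgle : g ≤ Real.exp (c₀ - Real.log β) := gain_le K₀ D₁ hβ1
  have hneg : c₀ - Real.log β ≤ 0 := by linarith
  -- the power of the gain
  have hn : A * β ≤ ((⌈A * β⌉₊ + 1 : ℕ) : ℝ) := by
    push_cast
    have := Nat.le_ceil (A * β)
    linarith
  have hpow : g ^ (⌈A * β⌉₊ + 1) ≤ Real.exp (A * β * (c₀ - Real.log β)) := by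
    calc g ^ (⌈A * β⌉₊ + 1) ≤ Real.exp (c₀ - Real.log β) ^ (⌈A * β⌉₊ + 1) := pow_le_pow_left₀ hg0 hgle _
      _ = Real.exp (((⌈A * β⌉₊ + 1 : ℕ) : ℝ) * (c₀ - Real.log β)) := (Real.exp_nat_mul _ _).symm
      _ ≤ Real.exp (A * β * (c₀ - Real.log β)) :=
          Real.exp_le_exp.2 (mul_le_mul_of_nonpos_right hn hneg)
  -- the mesh factor
  have hb4 : (2 * (b : ℝ)) ^ 4 ≤ 16 * Real.exp (4 * C * β) := two_mul_pow_four_le hb hbC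
  -- the exponent is at most `-β`
  have hexp : 4 * C * β + A * β * (c₀ - Real.log β) ≤ -β := by
    have : 4 * C * β + A * β * (c₀ - Real.log β) = β * (4 * C + A * c₀ - A * Real.log β) := by ring
    rw [this]
    nlinarith
  -- `576 e^{-β} ≤ δ`
  have hfin : 576 * Real.exp (-β) ≤ δ := by
    have h1 : 576 / δ ≤ Real.exp β := (Real.log_le_iff_le_exp (by positivity)).1 hβδ
    rw [div_le_iff₀ hδ] at h1
    have h2 : Real.exp (-β) * Real.exp β = 1 := by rw [← Real.exp_add]; simp
    nlinarith [Real.exp_pos (-β), Real.exp_pos β]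
  calc 36 * (2 * (b : ℝ)) ^ 4 * g ^ (⌈A * β⌉₊ + 1)
      ≤ 36 * (16 * Real.exp (4 * C * β)) * Real.exp (A * β * (c₀ - Real.log β)) := by gcongr
    _ = 576 * Real.exp (4 * C * β + A * β * (c₀ - Real.log β)) := by rw [Real.exp_add]; ring
    _ ≤ 576 * Real.exp (-β) := by gcongr
    _ ≤ δ := hfin

/-! ### §2 The torus anchor at the card's scales, in the quantifier order of `OnsetMixingTypical` -/

/-- **Clause (iii_T) for the ball-sparse factor at the card's scales, eventually below every budget.**  For every
lattice representation `r`, every `A > 0` and every `C` there is `K > 0` (namely `72 (5 + D₁/6)`) such that for every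
`δ > 0` there is `β₂ ≥ 1` with: for all `β ≥ β₂`, all meshes `b ≥ 1` with `log b ≤ C β`, every mesh-`b` grid `w`, every
odd torus `2S+1 ≥ 4b` and every finite `F` inside `[-S, S]⁴`,
`μ_{2S+1,β} {V | ∀ c ∈ F, torusLift V ∉ typBallSparse r.ρ w (K log β / β) ⌈β⌉₊ ⌈A β⌉₊ c} ≤ ofReal (δ ^ #F)`. -/
theorem torusAnchor_typBallSparse_eventually (r : LatticeRep G) {A : ℝ} (hA : 0 < A) (C : ℝ) :
    ∃ K : ℝ, 0 < K ∧ ∀ δ : ℝ, 0 < δ → ∃ β₂ : ℝ, 1 ≤ β₂ ∧ ∀ β : ℝ, β₂ ≤ β →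
      ∀ b : ℕ, 1 ≤ b → Real.log b ≤ C * β →
        ∀ w : Fin 4 → ℤ → ℤ,
          (∀ i j, w i j + ((b : ℕ) : ℤ) ≤ w i (j + 1) ∧ w i (j + 1) ≤ w i j + 2 * ((b : ℕ) : ℤ)) →
            ∀ S : ℕ, 4 * b ≤ 2 * S + 1 → ∀ F : Finset (Fin 4 → ℤ),
              (∀ c ∈ F, ∀ i, -(S : ℤ) ≤ w i (c i) ∧ w i (c i + 1) ≤ (S : ℤ) + 1) →
                (wilsonMeasure (d := 4) (L := 2 * S + 1) r.ρ β)
                    {V : GaugeConfig 4 (2 * S + 1) G | ∀ c ∈ F, torusLift (2 * S + 1) V ∉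
                      typBallSparse r.ρ w (K * Real.log β / β) ⌈β⌉₊ ⌈A * β⌉₊ c} ≤
                  ENNReal.ofReal (δ ^ #F) := by
  classical
  obtain ⟨K₀, D₁, h⟩ := torusAnchor_typBallSparse (G := G) r
  refine ⟨72 * (5 + (D₁ : ℝ) / 6), by positivity, fun δ hδ => ?_⟩
  set c₀ : ℝ := Real.log (6 * 9 ^ 4) + K₀ / 6 with hc₀
  refine ⟨max 1 (max (Real.exp c₀) (max (Real.exp ((4 * C + A * c₀ + 1) / A)) (Real.log (576 / δ)))),
    le_max_left _ _, fun β hβ b hb hbC w hw S hS F hin => ?_⟩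
  have hβ1 : 1 ≤ β := (le_max_left _ _).trans hβ
  have hβ0 : 0 < β := by linarith
  have hβ' := (le_max_right _ _).trans hβ
  have hβc₀ : c₀ ≤ Real.log β := by
    rw [Real.le_log_iff_exp_le hβ0]
    exact (le_max_left _ _).trans hβ'
  have hβC : 4 * C + A * c₀ + 1 ≤ A * Real.log β := by
    have h1 : (4 * C + A * c₀ + 1) / A ≤ Real.log β := by
      rw [Real.le_log_iff_exp_le hβ0]
      exact ((le_max_left _ _).trans ((le_max_right _ _).trans hβ'))
    have h2 := (div_le_iff₀ hA).1 h1
    linarith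
  have hβne : β ≠ 0 := hβ0.ne'
  have hβδ : Real.log (576 / δ) ≤ β := (le_max_right _ _).trans ((le_max_right _ _).trans hβ')
  have hmain := h β hβ1 (β / 2) (by linarith) (by linarith) b hb (72 * (5 + (D₁ : ℝ) / 6) * Real.log β / β)
    ⌈β⌉₊ ⌈A * β⌉₊ w hw S hS F hin
  refine hmain.trans (ENNReal.ofReal_le_ofReal (pow_le_pow_left₀ (by positivity) ?_ _))
  have hE : Real.exp (-(β / 2 * (72 * (5 + (D₁ : ℝ) / 6) * Real.log β / β * ((⌈A * β⌉₊ : ℝ) + 1))) /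
        (Fintype.card (Orient 4) : ℝ) ^ 2 +
      ((⌈A * β⌉₊ + 1 : ℕ) : ℝ) * (K₀ + D₁ * Real.log β) / (Fintype.card (Orient 4) : ℝ)) =
      Real.exp (-(72 * (5 + (D₁ : ℝ) / 6)) * Real.log β / 72 + (K₀ + D₁ * Real.log β) / 6) ^ (⌈A * β⌉₊ + 1) := by
    rw [← Real.exp_nat_mul, card_orient_four]
    congr 1
    push_cast
    field_simp
    ring
  rw [hE]
  simp only [card_orient_four]
  push_cast
  have := budget_le K₀ D₁ (A := A) (C := C) hδ hβ1 hβc₀ hβC hβδ hb hbC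
  generalize Real.exp (-(72 * (5 + (D₁ : ℝ) / 6)) * Real.log β / 72 + (K₀ + D₁ * Real.log β) / 6) = E at this ⊢
  generalize (4 * (⌈β⌉₊ : ℝ) + 1) ^ 4 * 6 = B at this ⊢
  generalize (2 * (b : ℝ)) ^ 4 = X at this ⊢
  rw [mul_pow] at this
  refine Eq.trans_le ?_ this
  ring

/-! ### §3 The ball-sparse factor composed with sup-`ζ`-rare factors -/

/-- **Clause (iii_T) for `typBallSparse ∩ Typ₂` with budget `δ_bs + δ₂`** (`Typ₂` cell-local measurable with
single-cell sup-`ζ` kernel rarity `δ₂`, e.g. a finite intersection of bulk factors): the mixed torus upgrade fed with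
the torus anchor of the ball-sparse factor. -/
theorem torusJointRarity_typBallSparse_inter [SecondCountableTopology G] (r : LatticeRep G) :
    ∃ K₀ : ℝ, ∃ D₁ : ℕ, ∀ (β : ℝ), 1 ≤ β → ∀ (lam : ℝ), 0 ≤ lam → lam ≤ β → ∀ (b : ℕ), 1 ≤ b →
      ∀ (t₀ : ℝ) (R D : ℕ) (w : Fin 4 → ℤ → ℤ),
        (∀ i j, w i j + ((b : ℕ) : ℤ) ≤ w i (j + 1) ∧ w i (j + 1) ≤ w i j + 2 * ((b : ℕ) : ℤ)) →
          ∀ (Typ₂ : (Fin 4 → ℤ) → Set (LGConfig 4 G)), (∀ c, MeasurableSet (Typ₂ c)) →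
            (∀ c, DependsOn (fun σ : LGConfig 4 G => σ ∈ Typ₂ c) ↑(cellEdges w c)) →
              ∀ (δ₂ : ℝ), 0 ≤ δ₂ →
                (∀ (c : Fin 4 → ℤ) (ζ : LGConfig 4 G),
                  (ymSpecification r.ρ β (regionEdges w {c}) ζ) (Typ₂ c)ᶜ ≤ ENNReal.ofReal δ₂) →
                  ∀ S : ℕ, 4 * b ≤ 2 * S + 1 → ∀ F : Finset (Fin 4 → ℤ), F.Nonempty →
                    (∀ c ∈ F, ∀ i, -(S : ℤ) ≤ w i (c i) ∧ w i (c i + 1) ≤ (S : ℤ) + 1) →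
                      (wilsonMeasure (d := 4) (L := 2 * S + 1) r.ρ β)
                          {V : GaugeConfig 4 (2 * S + 1) G | ∀ c ∈ F, torusLift (2 * S + 1) V ∉
                            typBallSparse r.ρ w t₀ R D c ∩ Typ₂ c} ≤
                        ENNReal.ofReal
                          ((((((2 * b) ^ 4 * Fintype.card (Orient 4) : ℕ) : ℝ) *
                                ((((4 * R + 1) ^ 4 * Fintype.card (Orient 4) : ℕ) : ℝ) ^ (D + 1)) *
                              ((Fintype.card (Orient 4) : ℝ) *
                                Real.exp (-(lam * (t₀ * (D + 1))) / (Fintype.card (Orient 4) : ℝ) ^ 2 +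
                                  ((D + 1 : ℕ) : ℝ) * (K₀ + D₁ * Real.log β) / Fintype.card (Orient 4))) +
                            δ₂) ^ F.card)) := by
  obtain ⟨K₀, D₁, h⟩ := torusAnchor_typBallSparse (G := G) r
  refine ⟨K₀, D₁, fun β hβ lam hlam hlamβ b hb t₀ R D w hw Typ₂ hTm₂ hTd₂ δ₂ hδ₂ h₂ => ?_⟩
  exact IRRarityUpgrade.torusJointRarity_inter r.ρ r.continuous β hb hw
    (measurableSet_typBallSparse r.ρ r.continuous w t₀ R D) (typBallSparse_dependsOn r.ρ w t₀ R D) hTm₂ hTd₂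
    (by positivity) hδ₂ (fun S hS F hin => h β hβ lam hlam hlamβ b hb t₀ R D w hw S hS F hin) h₂

end Summit.QuantumFields.YangMills.Theorems.OddTorusChessboard

end
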